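import Mathlib.Computability.TuringMachine.Computable
import Mathlib.Analysis.SpecialFunctions.Pow.Real
import Mathlib.Analysis.Real.Sqrt
import Literature.Algebra.EuclideanLattices.Problems
import Literature.Algebra.EuclideanLattices.Encoding
import Literature.Algebra.EuclideanLattices.LatticeProblems
import Literature.Computability.Complexity.BoolEncodings
import Literature.Computability.Complexity.Promise
import Literature.Computability.Complexity.Nondeterministic
import Literature.Computability.Complexity.Randomized
import Literature.Computability.Cryptography.QuantumCircuit
import Literature.Computability.Cryptography.ClassBQP
import Literature.Computability.Cryptography.DihedralCosetProblem
import HarnessLib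
import HarnessLib.Audit

-- provenance: harness21/H21/H21/Statements/PQC/LatticeComplexity.lean @ a991ad1 (interim HEAD d8f2665); M5 mechanical rewrite
/-!
# PQC family: complexity of the lattice promise problems `GapSVP`, `GapCVP`, `uSVP`

Family `pqc`, trunk T-LATTICE (G10), item `PQCLatticeComplexity`. Namespace `Literature.PQC`.

This statement file wraps the YES/NO sets `GapSVP.yes/no γ`, `GapCVP.yes/no γ`
(`H21/Prelude/Lattice/Problems`) and their Boolean encodings
(`H21/Prelude/Lattice/Encoding`) into G01's `PromiseProblem`s (`gapSVPPromise γ`,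
`gapCVPPromise γ`) and records four complexity statements:

* **pqc.S16** (Aharonov–Regev, *Lattice problems in NP ∩ coNP*, J. ACM 52 (2005), Thm. 1.1):
  `GapSVP_{c√n}, GapCVP_{c√n} ∈ PromiseNP ∩ PromiseCoNP` for some `c > 0`;
* **pqc.S17** (Khot, *Hardness of approximating the shortest vector problem in lattices*,
  J. ACM 52 (2005), Thm. 1.1; Micciancio, SIAM J. Comput. 30 (2001), Thm. 3 for `γ < √2`):
  `GapSVP_γ` is NP-hard under randomised reductions for every constant `γ ≥ 1`;
* **pqc.S25** (flag / wall; Regev, J. ACM 56 (2009), §1; Peikert, *A decade of lattice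
  cryptography* (2016), §4): the conjecture `GapSVP_γ ∉ PromiseBQP` for every polynomial `γ`,
  as a `def … : Prop` only — a REGISTERED OPEN CONJECTURE (`OPEN CONJECTURE — … [status: open]`,
  CONVENTIONS §4), not named-fact debt: posed in Regev 2009, §1, proved nowhere, so no
  `GapSVPQuantumHardness_holds`; users take `(h : GapSVPQuantumHardness)` (name kept: users in
  this file and in `QuantumHardnessWall`);
* **pqc.S28** (Regev, *Quantum computation and lattice problems*, SIAM J. Comput. 33 (2004),
  Thm. 1.1): a solution to the dihedral coset problem with failure parameter `f` yields a
  polynomial-time quantum algorithm for `Θ(n^{1/2+2f})`-unique-SVP.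

## Dependencies (H21)

* G01 (`H21/Prelude/CplxCore`): `PromiseProblem`, `PromiseProblem.ofEncoding/ofLanguage`,
  `PromiseNP`, `PromiseCoNP`, `PromiseProblem.PolyTimeReducible`, `PromiseProblem.IsHard`,
  `NP`, `RandAlg`, `RandAlg.pr`, `RandAlg.IsPolyTime`, `RandAlg.ofDet`, `PolyTimeComputable`.
* G11 (`H21/Prelude/CryptoQuantFine`): `QCircuitFamily cliffordT`, `.IsOracleFree`,
  `.IsUniform`, `.kernelProb` (`QuantumCircuit`); `PromiseBQP` (`ClassBQP`) — G11 ships the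
  promise class, defined directly from the acceptance-probability functional (NOT as G01's
  `promiseLift BQP`, which is wrong for a semantic class), so it is USED here, not redefined;
  `DCP.HasSolution f` (`DihedralCosetProblem`).  The provisional quantum layer of the first
  version of this file (`Literature.PQC.QState/QGate/QCircuit/PromiseBQP/DCP.*`) is gone.
* G10: `GapSVP.yes/no`, `USVP.Promise/IsSolution` (`Lattice/Problems`),
  `gapSVPInstanceEncoding`, `LatticeInstance.encode`, `encodeIntVec` (`Lattice/Encoding`),
  `GapSVP.yesLang/noLang` (`Statements/PQC/LatticeProblems`).

## Local glue on G01 (candidates for upstreaming to `H21/Prelude/CplxCore/Promise`)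

G01 has deterministic Karp reductions of promise problems (`PromiseProblem.PolyTimeReducible`,
`PromiseProblem.IsHard C`) and randomised algorithms (`RandAlg`), and `H21/Prelude/CplxMeta/
RandReductions` has randomised many-one reductions of *languages* (`PolyTimeRandReducible`,
`IsRandHard`), but there is no randomised many-one reduction of *promise problems*.  We
define, as deliberate dot-notation extensions of `Literature.Computability.Complexity.PromiseProblem` mirroring
`PolyTimeReducible`/`IsHard`/`IsNPHard`: `PromiseProblem.RandPolyTimeReducible` (two-sided
bounded-error randomised Karp reduction), `PromiseProblem.IsRandHard C Q` and the abbreviation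
`PromiseProblem.IsNPHardRandomized Q := IsRandHard NP Q`, with the sanity lemmas
`PolyTimeReducible.randPolyTimeReducible` and `IsHard.isRandHard` (proved, modulo the explicit
hypothesis `hdet` = G01's known result `RandAlg.IsPolyTime.ofDet` at string functions).

Two-sided bounded error is the WEAKEST standard notion of randomised reduction.  Reductions
with one-sided error `≤ 1/3` (Khot 2005: YES ↦ YES always, NO ↦ NO with high probability) are
literally special cases.  Reverse-unfaithful-random (RUR) reductions in the sense of Johnson /
Micciancio 2001 (NO ↦ NO always, YES ↦ YES with non-negligible probability `p`) imply ours
after the standard amplification for `GapSVP`: take the direct (orthogonal) sum of `k`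
independent output lattices — `λ₁` of an orthogonal sum is the minimum of the `λ₁`'s, so NO is
preserved and the YES-probability becomes `1 - (1 - p)^k ≥ 2/3`.  Hence NP-hardness proved in
print under either notion implies `IsNPHardRandomized` as defined here.

## Mathlib

Mathlib has `Turing.TM2ComputableInPolyTime`, `Computability.Encoding`, `PMF`,
`Polynomial.eval`, `Real.sqrt`, `Real.rpow`, `List.IsPrefix`, but no promise problems, no
randomised reductions (only the untimed deterministic `ManyOneReducible`), no BQP, no lattice
problems (searched `PromiseProblem`, `BQP`, `randomi`, `Reducible`, `GapSVP`, `unique SVP`,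
`dihedral`).  Nothing is duplicated.

## Design choices / faithfulness flags

* `gapSVPPromise γ` carries no hypothesis `γ ≥ 1` (outline D3); disjointness is the lemma
  `gapSVPPromise_disjoint`.
* `IsPolyBoundedReal γ := ∃ p : Polynomial ℕ, ∀ n, γ n ≤ p.eval n` is THE shared helper of the
  PQC statement files for real approximation factors (outline §4.6; the sibling
  `LWEHardness` must not redefine it).
* S16 is stated with `fun n ↦ c * √n` for an existential absolute constant `c > 0`
  (Aharonov–Regev prove `c√n`; the inventory's `√n` suppresses the constant).
  `PromiseNP ∩ PromiseCoNP` are G01's `promiseLift NP ∩ promiseLift coNP`, correct for these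
  syntactic classes.
* S17 asks `1 ≤ γ₀` (for `γ₀ < 1` the problem is not a promise problem).  Two-sided error, see
  above.
* S25 is an open problem: `@[conjecture] def GapSVPQuantumHardness : Prop` only, never a
  theorem, registered as an OPEN statement (`[status: open]`; defact-verdict clean-up
  2026-08-15: statement unchanged, name kept because of its users).
* S28: the exponent is `1/2 + 2f` for a DCP solution with failure parameter `f > 0`
  (Regev 2004, Thm. 1.1 verbatim); the inventory's `1/2 + ε` is `ε = 2f`.  The output
  convention is G11's `FBQP` convention: the measured string begins with the self-delimiting
  code `encodeIntVec ⟨n, v⟩` of a shortest vector `v`.  Instances of dimension `n ≤ 1` are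
  excluded explicitly (`2 ≤ I.n`): for `n = 1`, `successiveMinimum L 2 = sInf ∅ = 0` is a junk
  value making `USVP.Promise` unsatisfiable (so the statement would be vacuous there rather
  than visibly excluded); for `n = 0` there is no nonzero vector.
-/

noncomputable section

open Computability Literature.Computability.Complexity Literature.Computability.Complexity.Nondeterministic Literature.Algebra.EuclideanLattices

/-! ### Local glue on G01: randomised reductions of promise problems -/

namespace Literature.Algebra.EuclideanLattices
section PromiseProblem
open Literature.Computability.Complexity (PromiseProblem)
open Literature.Computability.Complexity.PromiseProblem

/-- Randomised polynomial-time (Karp, many-one) reducibility of promise problems with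
two-sided bounded error: `Q₁.RandPolyTimeReducible Q₂` iff there is a probabilistic
polynomial-time algorithm `A : {0,1}* → {0,1}*` (a G01 `RandAlg` with `A.IsPolyTime id id`)
mapping every yes-instance of `Q₁` to a yes-instance of `Q₂` with probability `≥ 2/3` and
every no-instance of `Q₁` to a no-instance of `Q₂` with probability `≥ 2/3` (nothing is
required off the promise of `Q₁`).  This is the WEAKEST standard notion of randomised
reduction: one-sided-error reductions (Khot 2005, §2) are special cases, and RUR reductions
(Micciancio 2001, §2: no false negatives, YES preserved with non-negligible probability) imply
it for targets admitting YES-amplification such as `GapSVP` (direct sum of independent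
copies); so NP-hardness under those reductions implies NP-hardness in this sense.
LOCAL GLUE on G01 primitives, the promise analogue of `Literature.Computability.MetaComplexity.PolyTimeRandReducible`;
candidate for upstreaming to `H21/Prelude/CplxCore/Promise`.  Deliberate dot-notation
extension of `Literature.Computability.Complexity.PromiseProblem`. [Arora–Barak 2009, §7.6 (randomised reductions);
Micciancio–Goldwasser 2002, Ch. 4, §4.1; Khot, J. ACM 52 (2005), §2] [cite: Khot2005, §2] -/
def _root_.Literature.Computability.Complexity.PromiseProblem.RandPolyTimeReducible (Q₁ Q₂ : PromiseProblem) : Prop :=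
  ∃ A : RandAlg (List Bool) (List Bool), A.IsPolyTime id (id : List Bool → List Bool) ∧
    (∀ x ∈ Q₁.yes, (2 / 3 : ℝ) ≤ A.pr id x Q₂.yes) ∧
    (∀ x ∈ Q₁.no, (2 / 3 : ℝ) ≤ A.pr id x Q₂.no)

/-- `IsRandHard C Q`: the promise problem `Q` is `C`-hard under randomised (two-sided
bounded-error, polynomial-time, many-one) reductions: every language `L ∈ C`, viewed as the
promise problem `ofLanguage L`, satisfies `(ofLanguage L).RandPolyTimeReducible Q`.  The
randomised analogue of G01's `PromiseProblem.IsHard`.  LOCAL GLUE; candidate for upstreaming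
to `H21/Prelude/CplxCore/Promise`. [Arora–Barak 2009, §7.6; Goldreich, *On promise problems*
(2006), §1.2] [cite: AroraBarak2009, §7.6] -/
def _root_.Literature.Computability.Complexity.PromiseProblem.IsRandHard (C : Set (Language Bool)) (Q : PromiseProblem) : Prop :=
  ∀ L ∈ C, (ofLanguage L).RandPolyTimeReducible Q

/-- `Q.IsNPHardRandomized`: the promise problem `Q` is NP-hard under randomised (two-sided
bounded-error) polynomial-time many-one reductions, `IsRandHard NP Q`.  If such a `Q` were in
promise-`BPP` then `NP ⊆ BPP`. [Arora–Barak 2009, §7.6; Micciancio–Goldwasser 2002, Ch. 4,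
§4.1; Khot 2005, Thm. 1.1] [cite: AroraBarak2009, §7.6] -/
abbrev _root_.Literature.Computability.Complexity.PromiseProblem.IsNPHardRandomized (Q : PromiseProblem) : Prop :=
  IsRandHard NP Q

/-- A deterministic promise reduction is a randomised one (run it with no coins: G01
`RandAlg.ofDet`, `RandAlg.pr_ofDet`).  The hypothesis `hdet` is G01's known result
`RandAlg.IsPolyTime.ofDet` (a polynomial-time string function run coin-free is PPT; it needs
machine composition, vendored upstream as a named fact) at string functions `{0,1}* → {0,1}*`.
[Arora–Barak 2009, §7.1 (P ⊆ BPP) and §7.6] [cite: AroraBarak2009, §7.1 (P ⊆ BPP] -/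
theorem _root_.Literature.Computability.Complexity.PromiseProblem.PolyTimeReducible.randPolyTimeReducible
    (hdet : ∀ f : List Bool → List Bool, PolyTimeComputable id id f →
      (RandAlg.ofDet f).IsPolyTime id (id : List Bool → List Bool))
    {Q₁ Q₂ : PromiseProblem} (h : Q₁.PolyTimeReducible Q₂) : Q₁.RandPolyTimeReducible Q₂ := by
  classical
  obtain ⟨f, hf, hy, hn⟩ := h
  refine ⟨RandAlg.ofDet f, hdet f hf, fun x hx => ?_, fun x hx => ?_⟩
  · rw [RandAlg.pr_ofDet, if_pos (hy hx)]
    norm_num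
  · rw [RandAlg.pr_ofDet, if_pos (hn hx)]
    norm_num

/-- Hardness under deterministic Karp reductions implies hardness under randomised ones
(given G01's known result `RandAlg.IsPolyTime.ofDet` at string functions, hypothesis `hdet`).
[Arora–Barak 2009, §7.6] [cite: AroraBarak2009, §7.6] -/
theorem _root_.Literature.Computability.Complexity.PromiseProblem.IsHard.isRandHard
    (hdet : ∀ f : List Bool → List Bool, PolyTimeComputable id id f →
      (RandAlg.ofDet f).IsPolyTime id (id : List Bool → List Bool))
    {C : Set (Language Bool)} {Q : PromiseProblem} (h : PromiseProblem.IsHard C Q) : IsRandHard C Q :=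
  fun L hL => (h L hL).randPolyTimeReducible hdet

/-- Randomised NP-hardness follows from (deterministic Karp) NP-hardness (given G01's known
result `RandAlg.IsPolyTime.ofDet` at string functions, hypothesis `hdet`).
[Arora–Barak 2009, §7.6] [cite: AroraBarak2009, §7.6] -/
theorem _root_.Literature.Computability.Complexity.PromiseProblem.IsNPHard.isNPHardRandomized
    (hdet : ∀ f : List Bool → List Bool, PolyTimeComputable id id f →
      (RandAlg.ofDet f).IsPolyTime id (id : List Bool → List Bool))
    {Q : PromiseProblem} (h : Q.IsNPHard) : Q.IsNPHardRandomized :=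
  IsHard.isRandHard hdet h

/-- Randomised hardness is upward closed along deterministic reductions on the right:
if `Q` is `C`-hard under randomised reductions and `Q` Karp-reduces to `Q'`, then `Q'` is
`C`-hard under randomised reductions (compose the coins-free map after the randomised one).
The Lean proof needs composition of polynomial-time Turing machines
(`Turing.TM2ComputableInPolyTime`), which Mathlib does not yet provide; the fact is standard.
[Arora–Barak 2009, §7.6 and Thm. 2.8(1) (transitivity of `≤ₚ`)] [cite: AroraBarak2009, §7.6 and Thm. 2.8(1] -/
def _root_.Literature.Computability.Complexity.PromiseProblem.IsRandHard.of_polyTimeReducible : Prop :=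
  ∀ {C : Set (Language Bool)} {Q Q' : PromiseProblem},
    IsRandHard C Q → Q.PolyTimeReducible Q' → IsRandHard C Q'

end PromiseProblem
end Literature.Algebra.EuclideanLattices

namespace Literature.Algebra.EuclideanLattices

open Literature.Computability.Cryptography

/-! ### Polynomially bounded real sequences -/

/-- `IsPolyBoundedReal γ`: the real sequence `γ` (an approximation factor `γ(n)`) is
bounded by a polynomial with natural coefficients, `∃ p, ∀ n, γ n ≤ p(n)`.  Shared helper of
the PQC statement files (outline §4.6; G01 inlines `∃ p : Polynomial ℕ, …` in the same
style). [Regev, J. ACM 56 (2009), §1 ("polynomial approximation factors"); Arora–Barak 2009,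
§1.6] [cite: AroraBarak2009, §1.6] -/
def IsPolyBoundedReal (γ : ℕ → ℝ) : Prop :=
  ∃ p : Polynomial ℕ, ∀ n, γ n ≤ ((p.eval n : ℕ) : ℝ)

/-- A sequence bounded by a natural constant is polynomially bounded (constant polynomial);
e.g. the constant factors of S17. [Arora–Barak 2009, §1.6] [cite: AroraBarak2009, §1.6] -/
theorem IsPolyBoundedReal.of_le_const {γ : ℕ → ℝ} {C : ℕ} (h : ∀ n, γ n ≤ C) :
    IsPolyBoundedReal γ :=
  ⟨Polynomial.C C, fun n => by simpa using h n⟩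

/-- Monotonicity: a sequence dominated by a polynomially bounded one is polynomially bounded.
[Arora–Barak 2009, §1.6] [cite: AroraBarak2009, §1.6] -/
theorem IsPolyBoundedReal.mono {γ γ' : ℕ → ℝ} (h : γ ≤ γ') (h' : IsPolyBoundedReal γ') :
    IsPolyBoundedReal γ :=
  let ⟨p, hp⟩ := h'
  ⟨p, fun n => (h n).trans (hp n)⟩

/-- `√n`-type factors are polynomially bounded: `c √n ≤ ⌈c⌉₊ · (n + 1)`; e.g. the factor of
S16. [Arora–Barak 2009, §1.6] [cite: AroraBarak2009, §1.6] -/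
theorem isPolyBoundedReal_const_mul_sqrt (c : ℝ) :
    IsPolyBoundedReal fun n => c * Real.sqrt n := by
  refine ⟨Polynomial.C ⌈c⌉₊ * (Polynomial.X + 1), fun n => ?_⟩
  have hsqrt : Real.sqrt n ≤ (n : ℝ) + 1 := by
    rw [Real.sqrt_le_left (by positivity)]
    nlinarith [(Nat.cast_nonneg n : (0 : ℝ) ≤ n)]
  have hc : c ≤ (⌈c⌉₊ : ℝ) := Nat.le_ceil c
  simp only [Polynomial.eval_mul, Polynomial.eval_C, Polynomial.eval_add, Polynomial.eval_X,
    Polynomial.eval_one, Nat.cast_mul, Nat.cast_add, Nat.cast_one]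
  calc c * Real.sqrt n ≤ ⌈c⌉₊ * Real.sqrt n := by gcongr
    _ ≤ ⌈c⌉₊ * ((n : ℝ) + 1) := by gcongr

/-! ### `GapSVP_γ` and `GapCVP_γ` as promise problems over `{0,1}` -/

/-- The promise problem `GapSVP_γ` over `{0,1}`: yes-instances the codes of pairs `(B, d)`
with `λ₁(L(B)) ≤ d`, no-instances the codes of pairs with `λ₁(L(B)) > γ(n) d`
(`PromiseProblem.ofEncoding gapSVPInstanceEncoding (GapSVP.yes γ) (GapSVP.no γ)`).
[Micciancio–Goldwasser 2002, Ch. 1, §1.2; Goldreich 2006, §1.1] [cite: MicciancioGoldwasser2002, Ch. 1  §1.2] -/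
def gapSVPPromise (γ : ℕ → ℝ) : PromiseProblem :=
  PromiseProblem.ofEncoding gapSVPInstanceEncoding (GapSVP.yes γ) (GapSVP.no γ)

/-- The promise problem `GapCVP_γ` over `{0,1}`: yes-instances the codes of triples
`((B, t), d)` with `dist(t, L(B)) ≤ d`, no-instances those with `dist(t, L(B)) > γ(n) d`.
[Micciancio–Goldwasser 2002, Ch. 1, §1.2; Goldreich 2006, §1.1] [cite: MicciancioGoldwasser2002, Ch. 1  §1.2] -/
def gapCVPPromise (γ : ℕ → ℝ) : PromiseProblem :=
  PromiseProblem.ofEncoding gapCVPInstanceEncoding (GapCVP.yes γ) (GapCVP.no γ)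

/-- The yes-instances of `gapSVPPromise γ` form the language `GapSVP.yesLang γ`.
[Micciancio–Goldwasser 2002, Ch. 1, §1.2] [cite: MicciancioGoldwasser2002, Ch. 1  §1.2] -/
@[simp] theorem gapSVPPromise_yes (γ : ℕ → ℝ) : (gapSVPPromise γ).yes = GapSVP.yesLang γ := rfl

/-- The no-instances of `gapSVPPromise γ` form the language `GapSVP.noLang γ`.
[Micciancio–Goldwasser 2002, Ch. 1, §1.2] [cite: MicciancioGoldwasser2002, Ch. 1  §1.2] -/
@[simp] theorem gapSVPPromise_no (γ : ℕ → ℝ) : (gapSVPPromise γ).no = GapSVP.noLang γ := rfl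

/-- The yes-instances of `gapCVPPromise γ` form the language `GapCVP.yesLang γ`.
[Micciancio–Goldwasser 2002, Ch. 1, §1.2] [cite: MicciancioGoldwasser2002, Ch. 1  §1.2] -/
@[simp] theorem gapCVPPromise_yes (γ : ℕ → ℝ) : (gapCVPPromise γ).yes = GapCVP.yesLang γ := rfl

/-- The no-instances of `gapCVPPromise γ` form the language `GapCVP.noLang γ`.
[Micciancio–Goldwasser 2002, Ch. 1, §1.2] [cite: MicciancioGoldwasser2002, Ch. 1  §1.2] -/
@[simp] theorem gapCVPPromise_no (γ : ℕ → ℝ) : (gapCVPPromise γ).no = GapCVP.noLang γ := rfl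

/-- For `γ ≥ 1`, `gapSVPPromise γ` is a disjoint promise problem.
[Micciancio–Goldwasser 2002, Ch. 1, §1.2] [cite: MicciancioGoldwasser2002, Ch. 1  §1.2] -/
theorem gapSVPPromise_disjoint {γ : ℕ → ℝ} (hγ : ∀ n, 1 ≤ γ n) : (gapSVPPromise γ).Disjoint :=
  PromiseProblem.disjoint_ofEncoding _ (gapSVP_disjoint hγ)

/-- For `γ ≥ 1`, `gapCVPPromise γ` is a disjoint promise problem.
[Micciancio–Goldwasser 2002, Ch. 1, §1.2] [cite: MicciancioGoldwasser2002, Ch. 1  §1.2] -/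
theorem gapCVPPromise_disjoint {γ : ℕ → ℝ} (hγ : ∀ n, 1 ≤ γ n) : (gapCVPPromise γ).Disjoint :=
  PromiseProblem.disjoint_ofEncoding _ (gapCVP_disjoint hγ)

/-- A larger gap is an easier promise problem: for `γ ≤ γ'` pointwise the identity reduces
`GapSVP_{γ'}` to `GapSVP_γ`. [Micciancio–Goldwasser 2002, Ch. 1, §1.2] [cite: MicciancioGoldwasser2002, Ch. 1  §1.2] -/
theorem gapSVPPromise_polyTimeReducible_of_le {γ γ' : ℕ → ℝ} (h : γ ≤ γ') :
    (gapSVPPromise γ').PolyTimeReducible (gapSVPPromise γ) := by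
  refine ⟨id, PolyTimeComputable.id id, Set.mapsTo_id _, ?_⟩
  rintro _ ⟨p, hp, rfl⟩
  exact ⟨p, GapSVP.no_subset_no_of_le h hp, rfl⟩

/-! ### pqc.S16, pqc.S17: classical complexity of `GapSVP`, `GapCVP` -/

/-- **pqc.S16** (Aharonov–Regev 2005, Thm. 1.1, `GapSVP` half).  There is an absolute
constant `c > 0` such that `GapSVP_{c√n} ∈ PromiseNP ∩ PromiseCoNP`: some NP language and
some coNP language each contain every (code of a) YES instance and no NO instance.
(Membership in `PromiseNP` is elementary — a short vector is the witness; the content is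
`PromiseCoNP`.) [Aharonov–Regev, J. ACM 52 (2005), Thm. 1.1] [cite: AharonovRegev2005, Thm. 1.1   GapSVP  half] -/
def gapSVP_sqrt_mem_promiseNP_inter_promiseCoNP : Prop :=
  ∃ c : ℝ, 0 < c ∧
      gapSVPPromise (fun n => c * Real.sqrt n) ∈ PromiseNP ∩ PromiseCoNP

/-- **pqc.S16** (Aharonov–Regev 2005, Thm. 1.1, `GapCVP` half).  There is an absolute
constant `c > 0` such that `GapCVP_{c√n} ∈ PromiseNP ∩ PromiseCoNP`.
[Aharonov–Regev, J. ACM 52 (2005), Thm. 1.1] [cite: AharonovRegev2005, Thm. 1.1   GapCVP  half] -/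
def gapCVP_sqrt_mem_promiseNP_inter_promiseCoNP : Prop :=
  ∃ c : ℝ, 0 < c ∧
      gapCVPPromise (fun n => c * Real.sqrt n) ∈ PromiseNP ∩ PromiseCoNP

/-- **pqc.S17** (Khot 2005, Thm. 1.1; Micciancio 2001, Thm. 3 for `γ < √2`).  For every
constant `γ₀ ≥ 1`, `GapSVP_{γ₀}` (in the `ℓ₂` norm) is NP-hard under randomised
polynomial-time reductions.  Khot's reductions have one-sided error ("unless NP ⊆ RP"), a
special case of our two-sided `IsNPHardRandomized`; Micciancio's RUR reductions imply it after
YES-amplification by direct sums (module docstring).  Hence the printed theorems imply this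
statement. [Khot, J. ACM 52 (2005), Thm. 1.1; Micciancio, SIAM J. Comput. 30 (2001),
Thm. 3 / Cor. 4] [cite: Khot2005, Thm. 1.1] -/
def gapSVP_const_isNPHardRandomized : Prop :=
  ∀ γ₀ : ℝ, 1 ≤ γ₀ → (gapSVPPromise fun _ => γ₀).IsNPHardRandomized

/-! ### pqc.S25: the quantum-hardness wall for `GapSVP` -/

/-- OPEN CONJECTURE — **pqc.S25** (flag / wall), the standard worst-case *quantum*-hardness
assumption of lattice cryptography: `GapSVP_γ ∉ PromiseBQP` (G11's
`Literature.Computability.Cryptography.PromiseBQP`: poly-time uniform Clifford+T families,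
acceptance probability `≥ 2/3` on YES and `≤ 1/3` on NO instances) for EVERY polynomially
bounded approximation factor `γ ≥ 1` — no polynomial-time quantum algorithm approximates the
shortest vector to within any polynomial factor (equivalently, by
`gapSVPPromise_polyTimeReducible_of_le`, for every polynomial factor).
*Where posed.* Regev, J. ACM 56 (2009), Art. 34, §1, verbatim: "It is conjectured that there is
no classical (i.e., non-quantum) polynomial time algorithm that approximates them [`GapSVP`,
`SIVP`] to within any polynomial factor. […] One might even conjecture that there is no quantum
polynomial time algorithm that approximates `GapSVP` (or `SIVP`) to within any polynomial
factor. […] The only evidence supporting this conjecture is that there are no known quantum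
algorithms for lattice problems that outperform classical algorithms, even though this is
probably one of the most important open questions in the field of quantum computing. [If
forced to make a guess, the author would say that the conjecture is true.]"  Likewise Peikert,
Found. Trends TCS 10 (2016), Ch. 1, "Conjectured security against quantum attacks" ("no
efficient quantum algorithms are known for the problems typically used in lattice
cryptography; indeed, generic (and relatively modest) quantum speedups provide the only known
advantage over non-quantum algorithms"), and (full version, IACR ePrint 2015/939) §2.2.2
(`SVP_γ`, `GapSVP_γ`, `SIVP_γ`, `BDD_γ` "appear to be intractable, except for very large
approximation factors"; "importantly, the above also represents the state of the art for
quantum algorithms"), §4.2.2 ("no known quantum algorithms for `GapSVP_γ` or `SIVP_γ` that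
significantly outperform classical ones, beyond generic quantum speedups"), §4.2.3 ("the
conjectured quantum hardness of `GapSVP_γ` or `SIVP_γ` for `γ = Õ(n^{3/2})`").
*Status.* OPEN — a conjecture in every source, proved nowhere; since `GapSVP_γ ∈ PromiseNP` for
`γ ≥ 1`, a proof would separate `NP` from `BQP` (`GapSVPQuantumHardness.not_NP_subset_BQP`,
`GapSVPQuantumHardness.P_ne_NP` in `Literature.Algebra.EuclideanLattices.QuantumHardnessWall`).
Hence a registered open statement (CONVENTIONS §4: an open conjecture is a `def … : Prop`,
never asserted), taken as an explicit hypothesis `(h : GapSVPQuantumHardness)`; there is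
deliberately no `GapSVPQuantumHardness_holds`, so it is not literature debt.  Statement
unchanged; name kept (no `…Conjecture` rename) because of its in-tree users
(`GapSVPQuantumHardness.const` below, `QuantumHardnessWall`, and the docstrings of the route
theses `Summits/PneNP/PneNP/Theses/Lattice`, `…/LatticeMagic`). [Regev, J. ACM 56 (2009), §1;
Peikert 2016, Ch. 1, §2.2.2, §4.2.2, §4.2.3; Micciancio–Regev 2009, §1]
[cite: Regev2009, §1 (Introduction; posed there as a conjecture)] [status: open] -/
@[conjecture] def GapSVPQuantumHardness : Prop :=
  ∀ γ : ℕ → ℝ, IsPolyBoundedReal γ → (∀ n, 1 ≤ γ n) → gapSVPPromise γ ∉ PromiseBQP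

/-- Under the open conjecture `GapSVPQuantumHardness` (taken as a hypothesis), in particular
no constant-factor `GapSVP_{γ₀}`, `γ₀ ≥ 1`, is in `PromiseBQP` (constants are polynomially
bounded, `IsPolyBoundedReal.of_le_const`). [Regev 2009, §1; Peikert 2016, §4] [cite: Regev2009, §1] -/
theorem GapSVPQuantumHardness.const (h : GapSVPQuantumHardness) (γ₀ : ℝ) (hγ₀ : 1 ≤ γ₀) :
    gapSVPPromise (fun _ => γ₀) ∉ PromiseBQP :=
  h _ (IsPolyBoundedReal.of_le_const (C := ⌈γ₀⌉₊) fun _ => Nat.le_ceil γ₀) fun _ => hγ₀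

/-! ### pqc.S28: from the dihedral coset problem to unique-SVP -/

/-- The search relation of unique-SVP on Boolean strings, in G11's output convention
(`IsQSolvable`, `FBQP`): on the code `I.encode` of a lattice instance, the good outputs are the
measured strings beginning with the self-delimiting code `encodeIntVec ⟨n, v⟩` of some shortest
nonzero vector `v` of `L(B)` (`USVP.IsSolution I v`). [Regev, SIAM J. Comput. 33 (2004), §1
(unique-SVP); Aaronson 2010, §1 (FBQP output convention)] [cite: Aaronson2010, §1 (FBQP output convention] -/
def usvpOutputs (I : LatticeInstance) : Set (List Bool) :=
  {w | ∃ v : Fin I.n → ℤ, USVP.IsSolution I v ∧ encodeIntVec ⟨I.n, v⟩ <+: w}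

/-- **pqc.S28** (Regev 2004, Thm. 1.1).  If the dihedral coset problem with failure parameter
`f > 0` has a solution (G11 `DCP.HasSolution f`: a poly-time uniform Clifford+T family finding
the hidden shift with probability `1/poly(log N)` on all admissible inputs), then there is a
polynomial-time quantum algorithm for `Θ(n^{1/2 + 2f})`-unique-SVP: for some constant `c > 0`,
an oracle-free, polynomial-time uniform Clifford+T circuit family, run on the code of any
nonsingular integer basis `B` of dimension `n ≥ 2` with `λ₂(L(B)) ≥ c · n^{1/2+2f} · λ₁(L(B))`
and measured on all wires, outputs (a string beginning with the code `encodeIntVec ⟨n, v⟩` of)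
a shortest nonzero vector `v` of `L(B)` with probability at least `2/3`.  (The inventory's
exponent `1/2 + ε` is `ε = 2f`; `n ≤ 1` is excluded, see the module docstring.)
[Regev, *Quantum computation and lattice problems*, SIAM J. Comput. 33 (2004), Thm. 1.1] [cite: Regev2004, Thm. 1.1] -/
def usvp_of_dihedralCoset : Prop :=
  ∀ f : ℝ, 0 < f → DCP.HasSolution f →
    ∃ c : ℝ, 0 < c ∧ ∃ F : QCircuitFamily cliffordT, F.IsOracleFree ∧ F.IsUniform ∧
      ∀ I : LatticeInstance, 2 ≤ I.n →
        USVP.Promise (fun n => c * (n : ℝ) ^ (1 / 2 + 2 * f)) I →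
          (2 / 3 : ℝ) ≤ F.kernelProb 0 I.encode (usvpOutputs I)

end Literature.Algebra.EuclideanLattices
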